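import Summits.QuantumFields.YangMills.Theorems.BalabanUVNodesN15ColouredLiveBackgroundMatrixRate
import HarnessLib

/-!
# N15 = NE2 — Σ-col (J-b′): THE LIVE BACKGROUND MATRICES AS NAMED OBJECTS — `zLiveC`, `zLiveF`, their three letters and their vanishing at the trivial field
# (dag-n15-a g29, programme Σ-col, FILE (J-b′); node N15 = NE2; `--supports stmt-QuantumFields-27366 --as helper`, count-neutral; two plumbing `def`s + theorems)

WHY.  FILES (J-a)∕(J-b) state the letters of the live background matrix `Z(A′) = unitBondMatC((Q⊗1)∘(X(A′) − G⊗1)∘(Q*⊗1))` (dag-n15-c's glued covariant propagator, FILE 127∕128, minus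
Bałaban's `Δ_a⁻¹ ⊗ 1_ι`, sandwiched by `Q⊗1`, `Q*⊗1`) with the operator written out LITERALLY.  The consumers (the U-live site layer on dag-n15-c's carrier, FILE (J-c)) import further modules,
in whose context the same literal elaborates with different (defeq but syntactically distinct) instance terms — Lean's unifier then unfolds the glued propagator (recursion blow-up; the
g28 lesson on `B4.Idx (pbox M)` instances).  This file NAMES the two matrices IN THE CONTEXT OF (J-b) and restates the letters and the zero-field identity for the names, so that every
downstream file manipulates the constants `zLiveC`, `zLiveF` only (the two restatements here unfold the names ONCE, under `set_option maxRecDepth 8192` — the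
comparison of the unfolded body with the literal is a deep structural descent, nothing else).

WHAT.  §1 defs `zLiveC d mm ι a e hL m kk r A′` (coarse spacing `L^{−k}`, transporter `e^{ηĀ′}`, `Ā′ = gavgM π̂ A′`) and `zLiveF …` (fine spacing `L^{−(r+k)}`, transporter `e^{η′A′}`), both on the
coloured unit bonds of the cover; ★★★ `exists_zLive_letters` = (J-b) `exists_zc_letters` for the names ((i) ∧ (ii) ∧ (iii), one set of constants); ★ `exists_zLive_zero` — in FILE 133's regime,
AT THE ZERO POTENTIAL both matrices VANISH (FILE (I) `exists_cvGlued_zero_eq_tensorId_gOp`: `X(1) = G ⊗ 1_ι`).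
Honest label: naming + restatement; MODEL objects as FILE 130∕133; no layer of NE2 proved here; no count.
[cite: Balaban1984PropagatorsI, (1.18) p.20, (1.102)–(1.103) p.34, (1.71) p.30; Balaban1985BackgroundPropagators, Thm 3.1 (3.42) p.397 (η-rate: shape), (3.62)–(3.65) pp.402–403]
-/

noncomputable section

open scoped BigOperators Matrix Matrix.Norms.Frobenius

namespace Summit.QuantumFields.YangMills.BalabanUVNodes.N15.GluedZeroField

open Literature.MathematicalPhysics.QuantumFieldTheory.Balaban1983to89
open Literature.MathematicalPhysics.QuantumFieldTheory.Balaban1983to89.B5Prop11Plancherel (Tor fine)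
open Literature.MathematicalPhysics.QuantumFieldTheory.Balaban1983to89.B6Lemma24Torus (pbox)
open Literature.Barriers.QuantumFields (traceForm)
open Summit.QuantumFields.YangMills.BalabanUVNodes.N15.BackgroundLayer (gavgM gavgM_zero)
open Summit.QuantumFields.YangMills.BalabanUVNodes.N15.VectorPiece (bshiftEquiv kingPrV tensorId)
open Summit.QuantumFields.YangMills.BalabanUVNodes.N15.MatrixSpecies (basisConst)
open Summit.QuantumFields.YangMills.BalabanUVNodes.N15.TwoGrid (gOp qvRe qvAdjRe)
open Summit.QuantumFields.YangMills.BalabanUVNodes.N15.UnitLayerBgCol (unitBondMatC unitBondMatC_zero cdist)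
open Summit.QuantumFields.YangMills.BalabanUVNodes.N15.Gluing (cvM CvX CvX' cvNL cvNL' cvGlued cvGlued')

variable (d : ℕ) {L : ℕ} [NeZero L] (mm ι : Type) [Fintype mm] [DecidableEq mm] [Fintype ι] [DecidableEq ι] (a : ℝ) (e : Matrix mm mm ℂ ≃L[ℝ] (ι → ℝ))

/-! ## §1 The two live background matrices, named -/

/-- **THE LIVE BACKGROUND MATRIX, COARSE SPACING**: `Z(A′) = unitBondMatC((Q⊗1)∘(X(e^{ηĀ′}) − G⊗1)∘(Q*⊗1))` — dag-n15-c's glued covariant propagator of the block-mean bond field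
`e^{ηĀ′}`, `Ā′ = gavgM π̂ A′` (FILE 127 `cvGlued`) MINUS Bałaban's `Δ_a⁻¹ ⊗ 1_ι`, sandwiched by `Q⊗1`, `Q*⊗1`, read on the coloured unit bonds (the object of FILES (J-a)∕(J-b), literally).
[cite: Balaban1984PropagatorsI, (1.102)–(1.103) p.34; Balaban1985BackgroundPropagators, (3.62)–(3.65) pp.402–403 (shape)] -/
def zLiveC (hL : Odd L ∧ 1 < L) (m kk r : ℕ) (A' : Fin (d + 1) → CvX' d L m kk r hL → Matrix mm mm ℂ) :
    Matrix (B4.Idx (pbox (cvM d L m kk hL)) (d + 1) × ι) (B4.Idx (pbox (cvM d L m kk hL)) (d + 1) × ι) ℝ :=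
  unitBondMatC (cvM d L m kk hL) ι
    (tensorId ι (qvRe (cvM d L m kk hL) (L ^ kk)) ∘ₗ
      (cvGlued d L m kk hL a ((((L ^ kk : ℕ) : ℝ))⁻¹) ι e (fun _ _ => (1 : Matrix mm mm ℂ))
          (fun μ x => NormedSpace.exp (((((L ^ kk : ℕ) : ℝ))⁻¹) • gavgM (Matrix mm mm ℂ) (Fin (d + 1)) (kingPrV L kk r (cvM d L m kk hL)) A' μ x)) (cvNL d L m kk hL a ι) (fun _ => 0) -
        tensorId ι (gOp (cvM d L m kk hL) (L ^ kk) a)) ∘ₗ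
      tensorId ι (qvAdjRe (cvM d L m kk hL) (L ^ kk)))

/-- **THE LIVE BACKGROUND MATRIX, FINE SPACING**: `Z′(A′) = unitBondMatC((Q′⊗1)∘(X′(e^{η′A′}) − G′⊗1)∘(Q′*⊗1))` (FILE 128 `cvGlued'`), on the SAME coloured unit bonds.
[cite: Balaban1984PropagatorsI, (1.102)–(1.103) p.34; Balaban1985BackgroundPropagators, (3.62)–(3.65) pp.402–403 (shape)] -/
def zLiveF (hL : Odd L ∧ 1 < L) (m kk r : ℕ) (A' : Fin (d + 1) → CvX' d L m kk r hL → Matrix mm mm ℂ) :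
    Matrix (B4.Idx (pbox (cvM d L m kk hL)) (d + 1) × ι) (B4.Idx (pbox (cvM d L m kk hL)) (d + 1) × ι) ℝ :=
  unitBondMatC (cvM d L m kk hL) ι
    (tensorId ι (qvRe (cvM d L m kk hL) (L ^ r * L ^ kk)) ∘ₗ
      (cvGlued' d L m kk r hL a ((((L ^ r * L ^ kk : ℕ) : ℝ))⁻¹) ι e (fun _ _ => (1 : Matrix mm mm ℂ)) (fun μ x' => NormedSpace.exp (((((L ^ r * L ^ kk : ℕ) : ℝ))⁻¹) • A' μ x'))
          (cvNL' d L m kk r hL a ι) (fun _ => 0) -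
        tensorId ι (gOp (cvM d L m kk hL) (L ^ r * L ^ kk) a)) ∘ₗ
      tensorId ι (qvAdjRe (cvM d L m kk hL) (L ^ r * L ^ kk)))

/-! ## §2 The three letters, for the names -/

set_option maxRecDepth 8192 in
/-- ★★★ **THE THREE LETTERS OF THE LIVE BACKGROUND MATRICES** (FILE (J-b) `exists_zc_letters`, for the named objects): `∃ δ w₀ R₀ K > 0` (from `d, L, a, ι`) such that in FILE 133's
regime (i) `|zLiveC … A′ p q| ≤ K·κ_e·r_A·e^{−δ·cdist}`, (ii) `|zLiveF … A′ p q| ≤ K·κ_e·r_A·e^{−δ·cdist}`, (iii) `|zLiveF … A′ p q − zLiveC … A′ p q| ≤ K·((L^k)^{−1/16} + κ_e·r_A·L^{−k})·e^{−δ·cdist}`.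
[cite: Balaban1984PropagatorsI, (1.102)–(1.103) p.34; Balaban1984PropagatorsII, (2.52)–(2.56) pp.232–233; Balaban1985BackgroundPropagators, Thm 3.1 (3.42) p.397 (shape), (3.62)–(3.65) pp.402–403] -/
theorem exists_zLive_letters (hL : Odd L ∧ 1 < L) (hL7 : 7 ≤ L) (ha : 0 < a) [Nonempty ι] :
    ∃ δ w₀ R₀ K : ℝ, 0 < δ ∧ 0 < R₀ ∧ 0 < K ∧
      ∀ (mv kk r : ℕ), 1 ≤ kk → w₀ ≤ ((L ^ mv : ℕ) : ℝ) →
      (∀ A B : Matrix mm mm ℂ, traceForm A B = e A ⬝ᵥ e B) →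
      ∀ (A' : Fin (d + 1) → CvX' d L mv kk r hL → Matrix mm mm ℂ), (∀ μ x', (A' μ x')ᴴ = -A' μ x') →
      ∀ (rA : ℝ), 0 ≤ rA → (∀ μ x', ‖A' μ x'‖ ≤ rA) →
        (∀ μ κ x', ‖A' μ (bshiftEquiv (cvM d L mv kk hL) (L ^ r * L ^ kk) κ x') - A' μ x'‖ ≤ rA * ((((L ^ r * L ^ kk : ℕ) : ℝ))⁻¹)) →
        (∀ μ κ x', ‖(A' μ (bshiftEquiv (cvM d L mv kk hL) (L ^ r * L ^ kk) κ x') - A' μ x') -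
            (A' μ (bshiftEquiv (cvM d L mv kk hL) (L ^ r * L ^ kk) κ ((bshiftEquiv (cvM d L mv kk hL) (L ^ r * L ^ kk) μ).symm x')) -
              A' μ ((bshiftEquiv (cvM d L mv kk hL) (L ^ r * L ^ kk) μ).symm x'))‖ ≤ rA * ((((L ^ r * L ^ kk : ℕ) : ℝ))⁻¹) * ((((L ^ r * L ^ kk : ℕ) : ℝ))⁻¹)) →
        2 * ((1 + Fintype.card (Fin (d + 1))) * ((3 + 2 * ((d : ℝ) + 1)) * rA)) ≤ 1 →
        (14 * Real.exp 1 * (1 + Fintype.card (Fin (d + 1))) * basisConst e * ((1 + Fintype.card (Fin (d + 1))) * ((3 + 2 * ((d : ℝ) + 1)) * rA))) * (1 + Fintype.card (Fin (d + 1) ⊕ Fin (d + 1))) ≤ R₀ →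
        (∀ p q, |zLiveC d mm ι a e hL mv kk r A' p q| ≤ K * basisConst e * rA * Real.exp (-(δ * cdist (cvM d L mv kk hL) ι p q))) ∧
        (∀ p q, |zLiveF d mm ι a e hL mv kk r A' p q| ≤ K * basisConst e * rA * Real.exp (-(δ * cdist (cvM d L mv kk hL) ι p q))) ∧
        (∀ p q, |zLiveF d mm ι a e hL mv kk r A' p q - zLiveC d mm ι a e hL mv kk r A' p q|
          ≤ K * ((((L ^ kk : ℕ) : ℝ)) ^ (-(1 / 16 : ℝ)) + basisConst e * rA * ((((L ^ kk : ℕ) : ℝ))⁻¹)) * Real.exp (-(δ * cdist (cvM d L mv kk hL) ι p q))) := by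
  obtain ⟨δ, w₀, R₀, K, hδ, hR₀, hK, H⟩ := exists_zc_letters (d := d) hL hL7 ha ι
  exact ⟨δ, w₀, R₀, K, hδ, hR₀, hK, fun mv kk r hk hw he A' hA' rA hrA h1 h2 h3 hr2 hRle => H mv kk r hk hw e he A' hA' rA hrA h1 h2 h3 hr2 hRle⟩

/-! ## §3 At the zero potential both matrices vanish -/

set_option maxRecDepth 8192 in
/-- ★ **AT THE ZERO POTENTIAL THE LIVE BACKGROUND MATRICES VANISH** (`L ≥ 7` odd, `a > 0`; in FILE 133's regime `k ≥ 1`, `L^m ≥ w₀`, trace-form-orthonormal `e`): the block mean of the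
zero potential is zero, both transporters are `1`, the glued propagators ARE `Δ_a⁻¹ ⊗ 1_ι` (FILE (I)), so `X − G⊗1 = 0` at both spacings. [cite: Balaban1984PropagatorsI, (1.71) p.30; Balaban1985BackgroundPropagators, (3.62)–(3.65) pp.402–403] -/
theorem exists_zLive_zero (hL : Odd L ∧ 1 < L) (hL7 : 7 ≤ L) (ha : 0 < a) :
    ∃ w₀ : ℝ, ∀ (mv kk r : ℕ), 1 ≤ kk → w₀ ≤ ((L ^ mv : ℕ) : ℝ) → (∀ A B : Matrix mm mm ℂ, traceForm A B = e A ⬝ᵥ e B) →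
      zLiveC d mm ι a e hL mv kk r 0 = 0 ∧ zLiveF d mm ι a e hL mv kk r 0 = 0 := by
  obtain ⟨w₀, H⟩ := exists_cvGlued_zero_eq_tensorId_gOp (d := d) hL hL7 ha ι
  refine ⟨w₀, fun mv kk r hk hw he => ?_⟩
  obtain ⟨h₁, h₂⟩ := H mv kk r hk hw e he
  constructor
  · unfold zLiveC
    simp only [gavgM_zero, Pi.zero_apply, smul_zero, NormedSpace.exp_zero]
    rw [h₁, sub_self, LinearMap.zero_comp, LinearMap.comp_zero, unitBondMatC_zero]
  · unfold zLiveF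
    simp only [Pi.zero_apply, smul_zero, NormedSpace.exp_zero]
    rw [h₂, sub_self, LinearMap.zero_comp, LinearMap.comp_zero, unitBondMatC_zero]

end Summit.QuantumFields.YangMills.BalabanUVNodes.N15.GluedZeroField

end
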